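import Literature.Computability.AlgebraicComplexity.ChowPullback
import Mathlib.Algebra.MvPolynomial.Coeff
import HarnessLib

/-!
# The ideal generated by the coefficients of a power of the generic product of linear forms

Setting of `ChowPullback.lean`: `k[Mat_m] = MvPolynomial (Fin m × Fin m) k`, the generic linear
forms `ℓ_j = ∑_i X_{(i,j)} v_i` (`genericLinForm m j`, polynomials in the auxiliary variables `v`
with coefficients in `k[Mat_m]`) and their product `ℓ_0 ⋯ ℓ_{m-1}` (`genericProduct m`), whose
`v`-coefficients are the pullbacks `chowPullback (X_d)` of the coordinate functions of `Sym^m`.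

**Result** (`monomial_mem_coeffIdeal`, `monomial_mem_span_coeff_genericProduct_pow`): for every
`t` there is a bound `a` such that every monomial of `k[Mat_m]` having degree `≥ a` in each column
of variables `X_{(·,j)}` lies in the ideal generated by the `v`-coefficients of
`(ℓ_0 ⋯ ℓ_{m-1})^t`.

Geometrically (`t = 1`): the common zero set of the pullbacks of the linear coordinates of `Sym^m`
inside `Mat_m = V^m` is the set of tuples with a zero column — the null cone of the product map
`φ_m : V^m → Chow_m`; Bürgisser–Hüttenhain–Ikenmeyer, Proc. AMS 145 (2017) = arXiv:1501.05528,
§3, Lemma 3 ("The morphism `ψ_n` is finite", after Brion, Manuscripta Math. 80 (1993)) is derived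
in print from exactly this (Landsberg, arXiv:1305.7387, proof of Prop. 7.8: "`u_1⋯u_n = 0` if and
only if some `u_j = 0`" and the graded Nakayama lemma, Lemmas 7.9–7.11). The effective
Nullstellensatz-free form proved here — a Dedekind–Mertens-type statement for products of linear
forms — is what the graded Nakayama argument (`ChowFiniteness.lean`) and the conductor argument
(`ChowCokernel.lean`) consume; general `t` is needed for the latter.

**Proof** (elementary, `X_pow_mul_coeff_mem_coeffIdeal`): peel off one form. With
`f = ℓ_{j₀}^t`, `G = ∏_{j ≠ j₀} ℓ_j^t`, the coefficient of `v^{β + t e_{i₀}}` in `f G` is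
`X_{(i₀,j₀)}^t · G_β` plus terms `f_α G_{β'}` with `β'_{i₀} > β_{i₀}`; descending induction on
`β_{i₀}` (bounded by the `v`-degree of `G`) shows `X_{(i₀,j₀)}^T G_β` lies in the coefficient
ideal of `f G`; induction on the set of forms (`prod_X_pow_mem_coeffIdeal`) and pigeonhole
(`monomial_mem_coeffIdeal`) finish.

## References

* [BurgisserHuttenhainIkenmeyer2017] §3, Lemma 3 (finiteness of `ψ_n`).
* J. M. Landsberg, arXiv:1305.7387, Prop. 7.8 and Lemmas 7.9–7.11.
-/

noncomputable section

open MvPolynomial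

namespace Literature.Computability.AlgebraicComplexity

variable {k : Type*} [Field k] (m : ℕ)

/-! ### The coefficient ideals -/

/-- The ideal of `k[Mat_m]` generated by the `v`-coefficients of `∏_{j ∈ S} ℓ_j^t` (for `S` = all
forms and `t = 1`: by the pullbacks of the linear coordinate functions of `Sym^m`, whose zero set
is the null cone of `φ_m`). [cite: BurgisserHuttenhainIkenmeyer2017, §3 (Lemma 3, the fibre of φ_n over 0)] -/
def coeffIdeal (S : Finset (Fin m)) (t : ℕ) : Ideal (MvPolynomial (Fin m × Fin m) k) :=
  Ideal.span (Set.range fun γ : Fin m →₀ ℕ =>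
    coeff γ (∏ j ∈ S, genericLinForm (k := k) m j ^ t))

/-- The generators of `coeffIdeal`. [folklore] -/
theorem coeff_prod_pow_mem_coeffIdeal (S : Finset (Fin m)) (t : ℕ) (γ : Fin m →₀ ℕ) :
    coeff γ (∏ j ∈ S, genericLinForm (k := k) m j ^ t) ∈ coeffIdeal (k := k) m S t :=
  Ideal.subset_span ⟨γ, rfl⟩

/-- For all forms, the coefficient ideal is generated by the coefficients of the `t`-th power of
the generic product. [folklore] -/
theorem coeffIdeal_univ (t : ℕ) :
    coeffIdeal (k := k) m Finset.univ t =
      Ideal.span (Set.range fun γ : Fin m →₀ ℕ => coeff γ (genericProduct (k := k) m ^ t)) := by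
  rw [coeffIdeal, genericProduct, Finset.prod_pow]

/-! ### Degrees and two coefficients of `ℓ_j^t` -/

/-- A generic linear form is linear in `v`. [folklore] -/
theorem genericLinForm_isHomogeneous (j : Fin m) :
    (genericLinForm (k := k) m j).IsHomogeneous 1 :=
  IsHomogeneous.sum _ _ _ fun i _ => by
    have h := (isHomogeneous_C (Fin m) (X (i, j) : MvPolynomial (Fin m × Fin m) k)).mul
      (isHomogeneous_X (MvPolynomial (Fin m × Fin m) k) i)
    rwa [zero_add] at h

/-- `∏_{j ∈ S} ℓ_j^t` is a form of degree `|S| t` in `v`. [folklore] -/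
theorem prod_genericLinForm_pow_isHomogeneous (S : Finset (Fin m)) (t : ℕ) :
    (∏ j ∈ S, genericLinForm (k := k) m j ^ t).IsHomogeneous (S.card * t) := by
  have h := IsHomogeneous.prod S (fun j => genericLinForm (k := k) m j ^ t) (fun _ => t)
    fun j _ => by simpa using (genericLinForm_isHomogeneous (k := k) m j).pow t
  simpa [Finset.sum_const, smul_eq_mul] using h

/-- **The coefficient of `v_{i₀}^t` in `ℓ_j^t` is `X_{(i₀,j)}^t`** (multinomial theorem).
[folklore] -/
theorem coeff_single_genericLinForm_pow (j i₀ : Fin m) (t : ℕ) :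
    coeff (Finsupp.single i₀ t) (genericLinForm (k := k) m j ^ t) =
      (X (i₀, j) : MvPolynomial (Fin m × Fin m) k) ^ t := by
  classical
  have hform : genericLinForm (k := k) m j =
      ∑ i : Fin m, (X (i, j) : MvPolynomial (Fin m × Fin m) k) • X i := by
    simp only [genericLinForm, smul_eq_C_mul]
  rw [hform, coeff_linearCombination_X_pow_of_fintype, if_pos (by simp)]
  have hmult : (Finsupp.single i₀ t).multinomial = 1 := by
    rw [← Finsupp.multinomial_of_support_subset (s := {i₀}) Finsupp.support_single_subset,
      Nat.multinomial_singleton]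
  rw [hmult, Nat.cast_one, one_mul,
    Finsupp.prod_single_index (h := fun r e => (X (r, j) : MvPolynomial (Fin m × Fin m) k) ^ e)
      (pow_zero _)]

/-- An exponent of degree `t` other than `t e_{i₀}` has `i₀`-th coordinate `< t`. [folklore] -/
theorem apply_lt_of_ne_single {α : Fin m →₀ ℕ} {i₀ : Fin m} {t : ℕ} (hdeg : α.degree = t)
    (hne : α ≠ Finsupp.single i₀ t) : α i₀ < t := by
  by_contra h
  have hi₀ : α i₀ = t := le_antisymm (hdeg ▸ Finsupp.le_degree i₀ α) (not_lt.mp h)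
  apply hne
  ext i
  by_cases hi : i = i₀
  · subst hi
    rw [Finsupp.single_eq_same, hi₀]
  · rw [Finsupp.single_apply, if_neg (Ne.symm hi)]
    have hsum : ∑ x, α x = t := by rw [← Finsupp.degree_eq_sum]; exact hdeg
    rw [← Finset.add_sum_erase _ _ (Finset.mem_univ i₀), hi₀] at hsum
    have hzero : ∑ x ∈ Finset.univ.erase i₀, α x = 0 := by omega
    exact Finset.sum_eq_zero_iff.mp hzero i (Finset.mem_erase.mpr ⟨hi, Finset.mem_univ i⟩)

/-! ### Peeling off one form -/

/-- **Peeling off the form `j₀`**: for `j₀ ∈ S` and every variable index `i₀`, multiplication by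
`X_{(i₀,j₀)}^{t((|S|-1)t+1)}` carries every `v`-coefficient of `∏_{j ∈ S, j ≠ j₀} ℓ_j^t` into the
coefficient ideal of `∏_{j ∈ S} ℓ_j^t` (descending induction on the `i₀`-th exponent, see the
module docstring). [cite: BurgisserHuttenhainIkenmeyer2017, §3 (Lemma 3)] -/
theorem X_pow_mul_coeff_mem_coeffIdeal {S : Finset (Fin m)} {j₀ : Fin m} (hj₀ : j₀ ∈ S)
    (i₀ : Fin m) (t : ℕ) (β : Fin m →₀ ℕ) :
    (X (i₀, j₀) : MvPolynomial (Fin m × Fin m) k) ^ (t * ((S.card - 1) * t + 1)) *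
        coeff β (∏ j ∈ S.erase j₀, genericLinForm (k := k) m j ^ t) ∈
      coeffIdeal (k := k) m S t := by
  classical
  set B := (S.card - 1) * t with hB
  set G₀ := ∏ j ∈ S.erase j₀, genericLinForm (k := k) m j ^ t with hG₀
  set f := genericLinForm (k := k) m j₀ ^ t with hf
  set x : MvPolynomial (Fin m × Fin m) k := X (i₀, j₀) with hx
  have hprod : f * G₀ = ∏ j ∈ S, genericLinForm (k := k) m j ^ t :=
    Finset.mul_prod_erase S (fun j => genericLinForm (k := k) m j ^ t) hj₀
  have hG₀hom : G₀.IsHomogeneous B := by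
    have h := prod_genericLinForm_pow_isHomogeneous (k := k) m (S.erase j₀) t
    rwa [Finset.card_erase_of_mem hj₀] at h
  have hfhom : f.IsHomogeneous t := by
    simpa using (genericLinForm_isHomogeneous (k := k) m j₀).pow t
  have hf₀ : coeff (Finsupp.single i₀ t) f = x ^ t := coeff_single_genericLinForm_pow m j₀ i₀ t
  -- the key claim, by strong induction on `n = B - β i₀`
  suffices H : ∀ n : ℕ, ∀ β : Fin m →₀ ℕ, B - β i₀ = n →
      x ^ (t * (n + 1)) * coeff β G₀ ∈ coeffIdeal (k := k) m S t by
    have h := H (B - β i₀) β rfl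
    obtain ⟨c, hc⟩ : ∃ c, t * ((S.card - 1) * t + 1) = t * (B - β i₀ + 1) + c :=
      Nat.exists_eq_add_of_le (Nat.mul_le_mul_left t (by omega))
    rw [hc, pow_add, mul_comm (x ^ _) (x ^ c), mul_assoc]
    exact Ideal.mul_mem_left _ _ h
  intro n
  induction n using Nat.strong_induction_on with
  | _ n ih =>
    intro β hβn
    set γ := β + Finsupp.single i₀ t with hγ
    have hmem : (Finsupp.single i₀ t, β) ∈ Finset.antidiagonal γ := by
      rw [Finset.mem_antidiagonal, hγ, add_comm]
    have hγI : coeff γ (f * G₀) ∈ coeffIdeal (k := k) m S t := by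
      rw [hprod]
      exact coeff_prod_pow_mem_coeffIdeal m S t γ
    rw [coeff_mul, ← Finset.add_sum_erase _ _ hmem] at hγI
    -- every remaining term, multiplied by `x^(t n)`, lies in the ideal
    have hrest : ∀ p ∈ (Finset.antidiagonal γ).erase (Finsupp.single i₀ t, β),
        x ^ (t * n) * (coeff p.1 f * coeff p.2 G₀) ∈ coeffIdeal (k := k) m S t := by
      intro p hp
      obtain ⟨hpne, hpanti⟩ := Finset.mem_erase.mp hp
      rw [Finset.mem_antidiagonal] at hpanti
      by_cases hdeg : p.1.degree = t
      · have hα : p.1 ≠ Finsupp.single i₀ t := by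
          intro h
          apply hpne
          have h2 : p.2 = β := by
            have := hpanti
            rw [h, hγ, add_comm] at this
            exact add_right_cancel this
          exact Prod.ext h h2
        have hlt : p.1 i₀ < t := apply_lt_of_ne_single m hdeg hα
        have hcoord : p.1 i₀ + p.2 i₀ = β i₀ + t := by
          have := congrArg (fun δ : Fin m →₀ ℕ => δ i₀) hpanti
          simpa [hγ] using this
        by_cases hbig : B < p.2 i₀
        · have hzero : coeff p.2 G₀ = 0 :=
            hG₀hom.coeff_eq_zero fun h => by
              have := Finsupp.le_degree i₀ p.2
              omega
          rw [hzero, mul_zero, mul_zero]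
          exact Ideal.zero_mem _
        · have hn' : B - p.2 i₀ < n := by omega
          have h := ih _ hn' p.2 rfl
          obtain ⟨c, hc⟩ : ∃ c, t * n = t * (B - p.2 i₀ + 1) + c :=
            Nat.exists_eq_add_of_le (Nat.mul_le_mul_left t (by omega))
          rw [hc, pow_add]
          have heq : x ^ (t * (B - p.2 i₀ + 1)) * x ^ c * (coeff p.1 f * coeff p.2 G₀) =
              x ^ c * coeff p.1 f * (x ^ (t * (B - p.2 i₀ + 1)) * coeff p.2 G₀) := by ring
          rw [heq]
          exact Ideal.mul_mem_left _ _ h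
      · rw [hfhom.coeff_eq_zero hdeg, zero_mul, mul_zero]
        exact Ideal.zero_mem _
    have hsum : x ^ (t * n) * ∑ p ∈ (Finset.antidiagonal γ).erase (Finsupp.single i₀ t, β),
        coeff p.1 f * coeff p.2 G₀ ∈ coeffIdeal (k := k) m S t := by
      rw [Finset.mul_sum]
      exact Ideal.sum_mem _ fun p hp => hrest p hp
    have htot := Ideal.mul_mem_left _ (x ^ (t * n)) hγI
    have hmain : x ^ (t * n) * (coeff (Finsupp.single i₀ t) f * coeff β G₀) ∈
        coeffIdeal (k := k) m S t := by
      have := Ideal.sub_mem _ htot hsum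
      rwa [mul_add, add_sub_cancel_right] at this
    rw [hf₀, ← mul_assoc, ← pow_add, show t * n + t = t * (n + 1) by ring] at hmain
    exact hmain

/-! ### All forms: products of powers of one variable per column -/

/-- **A product of high powers of one variable from each column lies in the coefficient ideal**:
for every choice `c j` of a variable index per form `j ∈ S`,
`∏_{j ∈ S} X_{(c j, j)}^T ∈ coeffIdeal S t` with `T = t((m-1)t+1)` (induction on `S` by peeling).
[cite: BurgisserHuttenhainIkenmeyer2017, §3 (Lemma 3)] -/
theorem prod_X_pow_mem_coeffIdeal (t : ℕ) (c : Fin m → Fin m) (S : Finset (Fin m)) :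
    ∏ j ∈ S, (X (c j, j) : MvPolynomial (Fin m × Fin m) k) ^ (t * ((m - 1) * t + 1)) ∈
      coeffIdeal (k := k) m S t := by
  classical
  set T := t * ((m - 1) * t + 1) with hT
  induction S using Finset.induction_on with
  | empty =>
    have h1 : (1 : MvPolynomial (Fin m × Fin m) k) ∈ coeffIdeal (k := k) m ∅ t := by
      have h := coeff_prod_pow_mem_coeffIdeal (k := k) m ∅ t 0
      rwa [Finset.prod_empty, coeff_zero_one] at h
    rw [Finset.prod_empty]
    exact h1
  | insert j₀ S hj₀ ih =>
    rw [Finset.prod_insert hj₀]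
    -- the exponent of the peeling lemma for `insert j₀ S` is at most `T`
    set T' := t * (((insert j₀ S).card - 1) * t + 1) with hT'
    have hcard : (insert j₀ S).card - 1 ≤ m - 1 := by
      have := Finset.card_le_univ (insert j₀ S)
      rw [Fintype.card_fin] at this
      omega
    obtain ⟨e, he⟩ : ∃ e, T = T' + e :=
      Nat.exists_eq_add_of_le (Nat.mul_le_mul_left t (by nlinarith))
    -- the product over `S` lies in `coeffIdeal S t = coeffIdeal ((insert j₀ S).erase j₀) t`
    have herase : (insert j₀ S).erase j₀ = S := Finset.erase_insert hj₀
    have hS : ∏ j ∈ S, (X (c j, j) : MvPolynomial (Fin m × Fin m) k) ^ T ∈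
        coeffIdeal (k := k) m ((insert j₀ S).erase j₀) t := by rwa [herase]
    -- peel: multiplication by `X_{(c j₀, j₀)}^T'` maps that ideal into `coeffIdeal (insert j₀ S) t`
    have hpeel : ∀ G ∈ coeffIdeal (k := k) m ((insert j₀ S).erase j₀) t,
        (X (c j₀, j₀) : MvPolynomial (Fin m × Fin m) k) ^ T' * G ∈
          coeffIdeal (k := k) m (insert j₀ S) t := by
      intro G hG
      refine Submodule.span_induction (p := fun G _ =>
        (X (c j₀, j₀) : MvPolynomial (Fin m × Fin m) k) ^ T' * G ∈
          coeffIdeal (k := k) m (insert j₀ S) t) ?_ ?_ ?_ ?_ hG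
      · rintro _ ⟨β, rfl⟩
        exact X_pow_mul_coeff_mem_coeffIdeal m (Finset.mem_insert_self j₀ S) (c j₀) t β
      · rw [mul_zero]
        exact Ideal.zero_mem _
      · intro a b _ _ ha hb
        rw [mul_add]
        exact Ideal.add_mem _ ha hb
      · intro r a _ ha
        rw [smul_eq_mul, mul_left_comm]
        exact Ideal.mul_mem_left _ _ ha
    have hsplit : (X (c j₀, j₀) : MvPolynomial (Fin m × Fin m) k) ^ T =
        X (c j₀, j₀) ^ e * X (c j₀, j₀) ^ T' := by
      rw [← pow_add, he, add_comm]
    rw [hsplit, mul_assoc]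
    exact Ideal.mul_mem_left _ _ (hpeel _ hS)

/-- **Monomials of high column degrees lie in the coefficient ideal**: every monomial of
`k[Mat_m]` whose degree in the variables `X_{(·,j)}` of each column `j` is at least
`m (t((m-1)t+1) - 1) + 1` lies in the ideal generated by the `v`-coefficients of
`(ℓ_0 ⋯ ℓ_{m-1})^t` (pigeonhole on each column and `prod_X_pow_mem_coeffIdeal`).
[cite: BurgisserHuttenhainIkenmeyer2017, §3 (Lemma 3)] -/
theorem monomial_mem_coeffIdeal (t : ℕ) (s : Fin m × Fin m →₀ ℕ)
    (hs : ∀ j : Fin m, m * (t * ((m - 1) * t + 1) - 1) + 1 ≤ ∑ i : Fin m, s (i, j)) (r : k) :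
    monomial s r ∈ coeffIdeal (k := k) m Finset.univ t := by
  classical
  set T := t * ((m - 1) * t + 1) with hT
  -- pigeonhole: a variable of exponent `≥ T` in each column
  have hchoice : ∀ j : Fin m, ∃ i : Fin m, T ≤ s (i, j) := by
    intro j
    by_contra h
    push Not at h
    have hle : ∑ i : Fin m, s (i, j) ≤ ∑ _i : Fin m, (T - 1) :=
      Finset.sum_le_sum fun i _ => by have := h i; omega
    rw [Finset.sum_const, Finset.card_univ, Fintype.card_fin, smul_eq_mul] at hle
    have := hs j
    omega
  choose c hc using hchoice
  -- split off `∏_j X_{(c j, j)}^T`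
  set s₀ : Fin m × Fin m →₀ ℕ := ∑ j : Fin m, Finsupp.single (c j, j) T with hs₀
  have hle : s₀ ≤ s := by
    intro v
    rw [hs₀, Finsupp.finsetSum_apply]
    rcases v with ⟨i, j⟩
    rw [Finset.sum_eq_single j (fun j' _ hj' => by
        rw [Finsupp.single_apply, if_neg (fun h => hj' (Prod.ext_iff.mp h).2)])
      (fun h => absurd (Finset.mem_univ j) h)]
    rw [Finsupp.single_apply]
    split_ifs with h
    · have hij : c j = i := congrArg Prod.fst h
      rw [← hij]
      exact hc j
    · exact Nat.zero_le _
  obtain ⟨s', hs'⟩ : ∃ s', s = s₀ + s' := ⟨s - s₀, (add_tsub_cancel_of_le hle).symm⟩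
  have hmono : monomial s r = monomial s' r * ∏ j : Fin m,
      (X (c j, j) : MvPolynomial (Fin m × Fin m) k) ^ T := by
    rw [hs', add_comm, ← mul_one r, ← monomial_mul, mul_one]
    congr 1
    rw [hs₀, monomial_sum_index, C_1, one_mul]
    refine Finset.prod_congr rfl fun j _ => ?_
    rw [X_pow_eq_monomial]
  rw [hmono]
  exact Ideal.mul_mem_left _ _ (prod_X_pow_mem_coeffIdeal (k := k) m t c Finset.univ)

/-- The same, for the ideal written with the `t`-th power of the generic product.
[cite: BurgisserHuttenhainIkenmeyer2017, §3 (Lemma 3)] -/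
theorem monomial_mem_span_coeff_genericProduct_pow (t : ℕ) (s : Fin m × Fin m →₀ ℕ)
    (hs : ∀ j : Fin m, m * (t * ((m - 1) * t + 1) - 1) + 1 ≤ ∑ i : Fin m, s (i, j)) (r : k) :
    monomial s r ∈ Ideal.span (Set.range fun γ : Fin m →₀ ℕ =>
      coeff γ (genericProduct (k := k) m ^ t)) := by
  rw [← coeffIdeal_univ]
  exact monomial_mem_coeffIdeal m t s hs r

end Literature.Computability.AlgebraicComplexity
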